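import Summits.ResolutionOfSingularities.ResolutionOfSingularities.Theorems.FrobeniusLadderFInjectiveMacaulayficationP3d4z4557NewtonKFan
import Summits.ResolutionOfSingularities.ResolutionOfSingularities.Theorems.FrobeniusLadderFInjectiveMacaulayficationFHalfRowOfWeaklyNondegenerate
import Summits.ResolutionOfSingularities.ResolutionOfSingularities.Theorems.FrobeniusLadderFInjectiveMacaulayficationFHalfRowOfToricCoverData
import Summits.ResolutionOfSingularities.ResolutionOfSingularities.Theorems.FrobeniusLadderFInjectiveMacaulayficationCensusBedsWeaklyNondegenerate
import Summits.ResolutionOfSingularities.ResolutionOfSingularities.Theorems.FrobeniusLadderFInjectiveMacaulayficationP3d4z4557PointKBlowupFull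
import Summits.ResolutionOfSingularities.ResolutionOfSingularities.Theorems.FrobeniusLadderFInjectiveMacaulayficationP3d4z4557PointFloor
import Summits.ResolutionOfSingularities.ResolutionOfSingularities.Theorems.FrobeniusLadderFInjectiveMacaulayficationGermOfGlobalBlowup
import HarnessLib

/-!
# ★★★ BED W BY THE CLASS THEOREM — the first APPLICATION of the class row ✓ p656605 `fHalfRow_of_weaklyNondegenerate` on a bed: the point floor of `z³ + x⁴ + y⁵ + u⁵ + t⁷`
# (p = 3) is cured by the monomial blowing up `𝔪·K` read off res-L1-w45a-stub-3's `Σ_f ∧ Σ(𝔪)` fan, with NO Fedder cell and NO strict-transform table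
# (crux `FInjectiveMacaulayfication` stmt-ResolutionOfSingularities-15315, chain w45a; res-L1-w45a-plan-1 RULING R21.38 (2) tail / R21.40 (2) / R22.2 (1) «BED W CLASS-ROUTE TWIN»;
# seat res-L1-w45a-stub-3 g12; a SECOND, independent proof of the cure half of row (4,3) #1 = res-L1-w45a-stub-2 g9's ✓ p660468 `P3d4z4557PointFloorRow.f4pos_row_p3_one` (61-chart
# fan found by search + thin Fedder cells); here: 441-chart NEWTON fan + weak non-degeneracy ✓ p656259 + kit job cover data ✓ `P3d4z4557NewtonK*`)

[OURS · L1 W4.5a] Support file (`--supports stmt-ResolutionOfSingularities-15315 --as helper`); def-free, unconditional; replaces the role of NO printed item;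
NOT a statement of the manuscript; AI-written (AI review is weaker than expert review).

`X = Spec (k[X₀..X₄]/(f))`, `f = X4 ^ 3 + X0 ^ 4 + X1 ^ 5 + X2 ^ 5 + X3 ^ 7` (BED W = P3d4z4557, res-L1-w45a-idea-1 FB5-r4 §3.4's p = 3 bed), `k = k̄` of characteristic 3, `v` = the
vertex, floor centre `𝔪 = (x̄, ȳ, ū, t̄, z̄)`, `A = 𝔪·K` = `genSet 5 P3d4z4557NewtonKFan.AL2` (13255 generators, `K` 𝔪-primary). THEN:
* §1 `affineBlowup_mK_fullCl_class` — `Bl_{𝔪·K} X` is FULL at EVERY point (one term on ✓ p656605 §2 `affineBlowup_fullCl_of_weaklyNondegenerate`);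
* §2 ★★★ `pointFloor_p3d4z4557_row_class` — for EVERY blowing up `g : S′ → Spec 𝒪_{X,v}` along `𝔪·𝒪_{X,v}` there is `𝓚 ≠ ⊥` on `S′`, supported over the closed point, ALL of
  whose blowings up are FULL at every stalk (one term on ✓ p656605 §3 `fHalfRow_of_weaklyNondegenerate`);
* §3 `f4pos_row_p3_one_class` — conjoined with res-L1-w45a-stub-3 g11's input legality / non-FULLness (`P3d4z4557PointFloor`): the two-sided row (4,3) #1 over `k = k̄`, by the class route;
* §4 `p3d4z4557_fInjectivizationGermAt_class` — the GERM TWIN `GermForm.FInjectivizationGermAt 3 v` (✓ `GermOfGlobalBlowup.fInjectivizationGermAt_of_affineBlowup` on §1; `𝔪 ⊆ √(𝔪·K)`).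
Inputs: `P3d4z4557Specimen.prime_f` / `regular_off_vertex`, `P3d4z4557PointKBlowupFull.mk_X_ne_zero_all`, ✓ p656259 `CensusBedsWeaklyNondegenerate.weaklyNondegenerate_bedW`
(`f_W` is WEAKLY non-degenerate along every positive weight: its vertex `z³` has vanishing Jacobian but no torus zero), the binders of `P3d4z4557NewtonKFan` (fan side read off kernel
checks; Newton side `hmin` ⇒ refining strict transforms `θ_{V c} f = Y^{V c·u₀ c} · g_c`, `g_c(0) ≠ 0` by `NewtonChartLemma.exists_theta_eq_monomial_mul_of_commonMinimiser`).
The only extra hypothesis w.r.t. the cells row is `k = k̄` (the class theorem's standing assumption).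
[OURS · certificate instance + assembly of landed theorems] [cite: IshiiSingularities2018, Thm. 4.4.23, Lemma 4.4.24, Cor. 4.4.25 (pp. 95–97)] [cite: StacksProject, Tag 080A]
[cite: GortzWedhorn2020, Prop. 13.91 (2)]
-/

-- single-problem summit: the doubled namespace component is forced
set_option linter.dupNamespace false

noncomputable section

open AlgebraicGeometry CategoryTheory Literature.AlgebraicGeometry.Resolution TopologicalSpace IsLocalRing MvPolynomial

namespace Summit.ResolutionOfSingularities.ResolutionOfSingularities.Theorems.FInjectiveMacaulayfication.P3d4z4557PointFloorRowClass

open Summit.ResolutionOfSingularities.ResolutionOfSingularities.Theorems.FInjectiveMacaulayfication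
open SliceableCentre FanCheckKit P3d4z4557NewtonKFan

/-! ## §0 The refining strict transforms from the Newton minimisers -/

/-- On every chart of the `Σ_f ∧ Σ(𝔪)` fan, `θ_{V c} f = Y^{V c · u₀ c} · g_c` with `g_c(0) ≠ 0` — the Newton chart lemma on the tabulated common minimiser.
[cite: IshiiSingularities2018, proof of Lemma 4.4.24 (p. 96)] -/
theorem exists_refining_strictTransform (k : Type) [Field k] (f : MvPolynomial (Fin 5) k) (hf : f = X 4 ^ 3 + X 0 ^ 4 + X 1 ^ 5 + X 2 ^ 5 + X 3 ^ 7) (c : Fin 441) :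
    ∃ g : MvPolynomial (Fin 5) k, aeval (fun j : Fin 5 => ∏ i : Fin 5, (X i : MvPolynomial (Fin 5) k) ^ Vq c i j) f =
      monomial (Finsupp.equivFunOnFinite.symm ((Vq c).mulVec ⇑(Finsupp.equivFunOnFinite.symm (U0 c) : Fin 5 →₀ ℕ))) 1 * g ∧ constantCoeff g ≠ 0 :=
  NewtonChartLemma.exists_theta_eq_monomial_mul_of_commonMinimiser (Vq c) (hV c) f _ (hu₀ k f hf c) (hmin k f hf c)

/-! ## §1 `Bl_{𝔪·K} X` is FULL everywhere -/

/-- ★ **`Bl_{𝔪·K} X_W` IS FULL AT EVERY POINT** (class route: weak non-degeneracy + Newton fan cover data; no Fedder cell). [OURS · certificate instance]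
[cite: IshiiSingularities2018, Thm. 4.4.23 and Cor. 4.4.25] -/
theorem affineBlowup_mK_fullCl_class (k : Type) [Field k] [IsAlgClosed k] [CharP k 3] (f : MvPolynomial (Fin 5) k)
    (hf : f = X 4 ^ 3 + X 0 ^ 4 + X 1 ^ 5 + X 2 ^ 5 + X 3 ^ 7) :
    ∀ y : ↥(affineBlowup (Ideal.span ((fun e : Fin 5 →₀ ℕ => Ideal.Quotient.mk (Ideal.span {f}) (monomial e (1 : k))) '' (genSet 5 AL2 : Set (Fin 5 →₀ ℕ))))),
      FullCl 3 ((affineBlowup (Ideal.span ((fun e : Fin 5 →₀ ℕ => Ideal.Quotient.mk (Ideal.span {f}) (monomial e (1 : k))) '' (genSet 5 AL2 : Set (Fin 5 →₀ ℕ))))).presheaf.stalk y) := by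
  classical
  haveI : Fact (Nat.Prime 3) := ⟨Nat.prime_three⟩
  choose g hθ hg0 using exists_refining_strictTransform k f hf
  exact FHalfRowOfNewtonNondegenerate.affineBlowup_fullCl_of_weaklyNondegenerate 3 k f (P3d4z4557Specimen.prime_f k f hf)
    (CensusBedsWeaklyNondegenerate.weaklyNondegenerate_bedW k f hf) (P3d4z4557PointKBlowupFull.mk_X_ne_zero_all k f hf)
    (fun x hx => P3d4z4557Specimen.regular_off_vertex k f hf x.asIdeal hx)
    (genSet 5 AL2) hprimAJ.2.1 hprimAJ.1 441 (chartM 5 AL2 CL 441) (hcov k) Vq hV (chartA 5 AL2 CL 441) haA hgen hge g _ hθ hg0 (P3d4z4557NewtonKFan.hv k _)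

/-! ## §2 ★★★ The cure of the point floor, by the class theorem -/

/-- ★★★ **THE d4p3d4z4557 POINT FLOOR IS CURED — BY THE CLASS THEOREM** (`k = k̄`, char 3). See the module docstring. [OURS · certificate instance]
[cite: IshiiSingularities2018, Thm. 4.4.23 and Cor. 4.4.25] [cite: StacksProject, Tag 080A] -/
theorem pointFloor_p3d4z4557_row_class (k : Type) [Field k] [IsAlgClosed k] [CharP k 3] (f : MvPolynomial (Fin 5) k)
    (hf : f = X 4 ^ 3 + X 0 ^ 4 + X 1 ^ 5 + X 2 ^ 5 + X 3 ^ 7)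
    (v : Spec (.of (MvPolynomial (Fin 5) k ⧸ Ideal.span {f})))
    (hv : v.asIdeal = Ideal.span (Set.range (fun j : Fin 5 => Ideal.Quotient.mk (Ideal.span {f}) (X j)))) :
    ∀ (S' : Scheme.{0}) (g : S' ⟶ Spec ((Spec (.of (MvPolynomial (Fin 5) k ⧸ Ideal.span {f}))).presheaf.stalk v)),
      IsBlowup g ((affineBlowup.idealSheaf (Ideal.span (Set.range (fun j : Fin 5 => Ideal.Quotient.mk (Ideal.span {f}) (X j))))).comap
        ((Spec (.of (MvPolynomial (Fin 5) k ⧸ Ideal.span {f}))).fromSpecStalk v)) →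
      ∃ 𝓚 : S'.IdealSheafData, 𝓚 ≠ ⊥ ∧
        (∀ s ∈ (𝓚.support : Set S'), g.base s = closedPoint ((Spec (.of (MvPolynomial (Fin 5) k ⧸ Ideal.span {f}))).presheaf.stalk v)) ∧
        ∀ (S'' : Scheme.{0}) (π : S'' ⟶ S'), IsBlowup π 𝓚 → ∀ s : S'', FullCl 3 (S''.presheaf.stalk s) := by
  classical
  haveI : Fact (Nat.Prime 3) := ⟨Nat.prime_three⟩
  choose g hθ hg0 using exists_refining_strictTransform k f hf
  exact FHalfRowOfNewtonNondegenerate.fHalfRow_of_weaklyNondegenerate 3 k (by norm_num) f (P3d4z4557Specimen.prime_f k f hf)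
    (CensusBedsWeaklyNondegenerate.weaklyNondegenerate_bedW k f hf) (P3d4z4557PointKBlowupFull.mk_X_ne_zero_all k f hf)
    (fun x hx => P3d4z4557Specimen.regular_off_vertex k f hf x.asIdeal hx)
    (genSet 5 AL2) (genSet 5 KL2) (span_A_eq_floor_mul_K k _).1 hKprim.1 hprimAJ.2.1 hprimAJ.1 441 (chartM 5 AL2 CL 441) (hcov k) Vq hV
    (chartA 5 AL2 CL 441) haA hgen hge g _ hθ hg0 (P3d4z4557NewtonKFan.hv k _) v hv

/-! ## §3 The two-sided row, by the class route -/

/-- ★★★ **ROW (4,3) #1 BY THE CLASS ROUTE: LEGAL ∧ NOT F(4)-iso (p = 3) ∧ CURED** (`k = k̄`). The first two conjuncts are res-L1-w45a-stub-3 g11's `P3d4z4557PointFloor`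
(input side), the third is §2. [OURS · assembly of landed theorems] -/
theorem f4pos_row_p3_one_class (k : Type) [Field k] [IsAlgClosed k] [CharP k 3] (f : MvPolynomial (Fin 5) k) (hf : f = X 4 ^ 3 + X 0 ^ 4 + X 1 ^ 5 + X 2 ^ 5 + X 3 ^ 7)
    (v : Spec (.of (MvPolynomial (Fin 5) k ⧸ Ideal.span {f})))
    (hv : v.asIdeal = Ideal.span (Set.range (fun j : Fin 5 => Ideal.Quotient.mk (Ideal.span {f}) (X j))))
    (S' : Scheme.{0}) (g : S' ⟶ Spec ((Spec (.of (MvPolynomial (Fin 5) k ⧸ Ideal.span {f}))).presheaf.stalk v))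
    (hg : IsBlowup g ((affineBlowup.idealSheaf (Ideal.span (Set.range (fun j : Fin 5 => Ideal.Quotient.mk (Ideal.span {f}) (X j))))).comap
      ((Spec (.of (MvPolynomial (Fin 5) k ⧸ Ideal.span {f}))).fromSpecStalk v))) :
    (((affineBlowup.idealSheaf (Ideal.span (Set.range (fun j : Fin 5 => Ideal.Quotient.mk (Ideal.span {f}) (X j))))).comap
        ((Spec (.of (MvPolynomial (Fin 5) k ⧸ Ideal.span {f}))).fromSpecStalk v)) ≠ ⊥ ∧
      (((((affineBlowup.idealSheaf (Ideal.span (Set.range (fun j : Fin 5 => Ideal.Quotient.mk (Ideal.span {f}) (X j))))).comap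
        ((Spec (.of (MvPolynomial (Fin 5) k ⧸ Ideal.span {f}))).fromSpecStalk v))).support :
          Set (Spec ((Spec (.of (MvPolynomial (Fin 5) k ⧸ Ideal.span {f}))).presheaf.stalk v))) ⊆
        (Scheme.regularLocus (Spec ((Spec (.of (MvPolynomial (Fin 5) k ⧸ Ideal.span {f}))).presheaf.stalk v)))ᶜ) ∧
      (∀ s : S', g.base s ≠ closedPoint ((Spec (.of (MvPolynomial (Fin 5) k ⧸ Ideal.span {f}))).presheaf.stalk v) → s ∈ Scheme.regularLocus S') ∧
      (∀ s : S', CMCl (S'.presheaf.stalk s))) ∧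
    (∃ s : S', g.base s = closedPoint ((Spec (.of (MvPolynomial (Fin 5) k ⧸ Ideal.span {f}))).presheaf.stalk v) ∧ ¬ FullCl 3 (S'.presheaf.stalk s)) ∧
    (∃ 𝓚 : S'.IdealSheafData, 𝓚 ≠ ⊥ ∧
      (∀ s ∈ (𝓚.support : Set S'), g.base s = closedPoint ((Spec (.of (MvPolynomial (Fin 5) k ⧸ Ideal.span {f}))).presheaf.stalk v)) ∧
      ∀ (S'' : Scheme.{0}) (π : S'' ⟶ S'), IsBlowup π 𝓚 → ∀ s : S'', FullCl 3 (S''.presheaf.stalk s)) :=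
  ⟨P3d4z4557PointFloor.pointFloor_p3d4z4557_input_legal k f hf v hv S' g hg, P3d4z4557PointFloor.pointFloor_p3d4z4557_not_full k f hf v hv S' g hg,
    pointFloor_p3d4z4557_row_class k f hf v hv S' g hg⟩

/-! ## §4 The germ twin -/

/-- ★ **THE GERM TWIN**: `FInjectivizationGermAt 3 v` — the F-half's ∃-conclusion at the germ of `X_W` at its vertex, witnessed by `(𝔪·K)·𝒪_{X,v}` (all of whose blowings up are
FULL everywhere by §1; `𝔪·K ≠ ⊥` and `𝔪 ⊆ √(𝔪·K)` from the pure powers in `A`). [OURS · certificate instance; cite: GortzWedhorn2020, Prop. 13.91 (2)] -/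
theorem p3d4z4557_fInjectivizationGermAt_class (k : Type) [Field k] [IsAlgClosed k] [CharP k 3] (f : MvPolynomial (Fin 5) k)
    (hf : f = X 4 ^ 3 + X 0 ^ 4 + X 1 ^ 5 + X 2 ^ 5 + X 3 ^ 7)
    (v : Spec (.of (MvPolynomial (Fin 5) k ⧸ Ideal.span {f})))
    (hv : v.asIdeal = Ideal.span (Set.range (fun j : Fin 5 => Ideal.Quotient.mk (Ideal.span {f}) (X j)))) :
    GermForm.FInjectivizationGermAt 3 v := by
  classical
  have hprime := P3d4z4557Specimen.prime_f k f hf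
  haveI hp : (Ideal.span {f}).IsPrime := (Ideal.span_singleton_prime hprime.ne_zero).mpr hprime
  haveI : IsDomain (MvPolynomial (Fin 5) k ⧸ Ideal.span {f}) := Ideal.Quotient.isDomain _
  refine GermOfGlobalBlowup.fInjectivizationGermAt_of_affineBlowup 3 _ ?_ v ?_ (affineBlowup_mK_fullCl_class k f hf)
  · obtain ⟨N, hN⟩ := hprimAJ.2.1 0 (Finset.mem_univ _)
    intro h0
    have hmem : Ideal.Quotient.mk (Ideal.span {f}) (monomial (Finsupp.single 0 N) (1 : k)) ∈
        Ideal.span ((fun e : Fin 5 →₀ ℕ => Ideal.Quotient.mk (Ideal.span {f}) (monomial e (1 : k))) '' (genSet 5 AL2 : Set (Fin 5 →₀ ℕ))) :=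
      Ideal.subset_span ⟨_, Finset.mem_coe.mpr hN, rfl⟩
    rw [h0, Ideal.mem_bot, ← X_pow_eq_monomial, map_pow] at hmem
    exact pow_ne_zero N (P3d4z4557PointKBlowupFull.mk_X_ne_zero_all k f hf 0) hmem
  · rw [hv, Ideal.span_le]
    rintro _ ⟨j, rfl⟩
    obtain ⟨N, hN⟩ := hprimAJ.2.1 j (Finset.mem_univ _)
    exact ⟨N, by rw [← map_pow, X_pow_eq_monomial]; exact Ideal.subset_span ⟨_, Finset.mem_coe.mpr hN, rfl⟩⟩

end Summit.ResolutionOfSingularities.ResolutionOfSingularities.Theorems.FInjectiveMacaulayfication.P3d4z4557PointFloorRowClass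

end
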